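import Summits.CriticalPhenomena.PercolationContinuityZ3.Theorems.PercNearOneGluingNoHeavyLowerTailQuantitativeBHKVertexFunStrict
import Summits.CriticalPhenomena.PercolationContinuityZ3.Theorems.PercNearOneGluingNoHeavyLowerTailQuantitativeHarrisInfluenceFunctions
import HarnessLib

/-!
# Separate pivotality somewhere forces joint pivotality somewhere (monotone vertex functionals of a cluster against a connection)

Support file (`--supports stmt-CriticalPhenomena-4575`), prover seat `prim-rate-mine-2` (lane prim-rate, constants-miner (c), BENCH row
M2-R46; `run/shared/lean/prim/prim-rate/prim-rate-mine-2/PROOFS.md` §P46).  No definitions, no named facts, no sorries; standard axioms.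

A purely combinatorial fact about a finite graph `(V, E)`, two vertices `x ≠ o` and a monotone functional `F` of vertex sets: if SOME pair `e ∈ E`
is SEPARATELY pivotal — at one configuration inside `E` it changes `F(C_x)`, at another it changes `1{x ↔ o}` — then SOME pair `e' ∈ E` (possibly
another one) is JOINTLY pivotal: at a single configuration it changes both.  The proof is probabilistic: put weight `1/2` on every pair of `E`;
separate pivotality is the equality case of Harris' inequality (`QuantHarris.cov_pos_iff_exists_influence`: `Cov(F(C_x), 1{x ↔ o}) > 0`), joint
pivotality is the equality case of the vdBHK one-cluster inequality at `X = ∅` (`CSH.covD_clusterFun_pos_iff`, row M2-R44), and at `X = ∅` the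
two covariances are the same number.

* `CSH.exists_jointly_pivotal_of_separately` — the statement above.

The PAIR-LEVEL version («a separately pivotal pair is jointly pivotal») is FALSE: on the 5-cycle `x – b – p – q – o – x` with `F = 1{b ∈ ·}` the pair
`pq` is separately but not jointly pivotal (the jointly pivotal pair is `ox`; lane file `refutations/M2-R46-EDGE.json`).  This is why the explicit
floors of the lane are stated with separate witnesses (`CSH.floor_iso_pos_of_pivotal`) while the certificates (C3) of rows M2-R43/45 are joint.
[cite: Harris1960, Lemma 4.1 (p. 16)] [cite: VandenbergHaggstromKahn2005, Thm. 1.3 (p. 6)]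
-/

noncomputable section

namespace Summit.CriticalPhenomena.PercolationContinuityZ3.Theorems

open MeasureTheory Set Literature.Probability.LatticeModels Literature.Probability.Percolation
open scoped Classical
open KNPreFKG

namespace CSH

variable {n : ℕ}

/-- **Separate pivotality somewhere ⟹ joint pivotality somewhere.**  `(V, E)` a finite graph (`E` any set of pairs), `x ≠ o`, `F` monotone on
vertex sets.  If a pair `e ∈ E` changes `F(C_x)` at some configuration inside `E` and changes `{x ↔ o}` at some (other) configuration inside `E`,
then some pair `e' ∈ E` changes both at one configuration inside `E`.  (Harris' equality case and the vdBHK equality case at `X = ∅` are loci of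
the same covariance under the weights `1/2` on `E`.) [cite: Harris1960, Lemma 4.1 (p. 16)] [cite: VandenbergHaggstromKahn2005, Thm. 1.3 (p. 6)] -/
theorem exists_jointly_pivotal_of_separately (E : Set (Sym2 (Fin n))) (x o : Fin n) (hox : o ≠ x)
    (F : Set (Fin n) → ℝ) (hF : ∀ S S' : Set (Fin n), S ⊆ S' → F S ≤ F S')
    (e : Sym2 (Fin n)) (he : e ∈ E)
    (hFpiv : ∃ η : Set (Sym2 (Fin n)), η ⊆ E ∧ F (openCluster (η \ {e}) x) < F (openCluster (insert e η) x))
    (hCpiv : ∃ η : Set (Sym2 (Fin n)), η ⊆ E ∧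
      insert e η ∈ (openConn x o : Set (BondConfig (Fin n))) ∧ η \ {e} ∉ (openConn x o : Set (BondConfig (Fin n)))) :
    ∃ e' ∈ E, ∃ η : Set (Sym2 (Fin n)), η ⊆ E ∧
      F (openCluster (η \ {e'}) x) < F (openCluster (insert e' η) x) ∧
      insert e' η ∈ (openConn x o : Set (BondConfig (Fin n))) ∧ η \ {e'} ∉ (openConn x o : Set (BondConfig (Fin n))) := by
  have hmeas : ∀ U : Set (BondConfig (Fin n)), MeasurableSet U := fun _ => MeasurableSet.of_discrete
  -- weights 1/2 on `E`
  set w : Sym2 (Fin n) → unitInterval := fun f => if f ∈ E then ⟨1 / 2, by norm_num, by norm_num⟩ else 0 with hw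
  have hE0 : ∀ f, f ∉ E → (w f : ℝ) = 0 := fun f hf => by simp only [hw, if_neg hf]; rfl
  have hE1 : ∀ f ∈ E, 0 < (w f : ℝ) ∧ (w f : ℝ) < 1 := fun f hf => by
    simp only [hw, if_pos hf]; norm_num
  -- the functional shifted to be nonnegative
  set F' : Set (Fin n) → ℝ := fun S => F S - F ∅ with hF'
  have hF'mono : ∀ S S' : Set (Fin n), S ⊆ S' → F' S ≤ F' S' := fun S S' h => by
    simp only [hF']; linarith [hF S S' h]
  have hF'0 : ∀ S : Set (Fin n), 0 ≤ F' S := fun S => by simp only [hF']; linarith [hF ∅ S (empty_subset S)]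
  set f : BondConfig (Fin n) → ℝ := fun ζ => F' (openCluster ζ x) with hfdef
  set U : Set (BondConfig (Fin n)) := openConn x o with hU
  have hUup : ∀ ω ω' : BondConfig (Fin n), ω ⊆ ω' → ω ∈ U → ω' ∈ U := fun ω ω' hle h =>
    SimpleGraph.Reachable.mono (BHK2006.openGraph_le hle) h
  have hfmono : Monotone f := fun ζ ζ' h => hF'mono _ _ fun a ha => SimpleGraph.Reachable.mono (BHK2006.openGraph_le h) ha
  have hf0 : ∀ ζ, 0 ≤ f ζ := fun _ => hF'0 _
  -- Harris' equality case: the covariance under the weights `1/2` is positive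
  have hharris := (QuantHarris.cov_pos_iff_exists_influence w E hE0 hE1 f (U.indicator fun _ => (1 : ℝ)) hf0
    (fun ω => Set.indicator_nonneg (fun _ _ => zero_le_one) ω) hfmono (QuantHarris.indicator_upset_monotone hUup)).2 (by
      obtain ⟨η₁, hη₁, hlt⟩ := hFpiv
      obtain ⟨η₂, hη₂, h1, h0⟩ := hCpiv
      refine ⟨e, he, ⟨η₁, hη₁, ?_⟩, ⟨η₂, hη₂, ?_⟩⟩
      · simp only [hfdef, hF']
        intro h
        linarith
      · rw [Set.indicator_of_mem h1, Set.indicator_of_notMem h0]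
        exact one_ne_zero)
  have hprod : (fun ζ => f ζ * U.indicator (fun _ => (1 : ℝ)) ζ) = U.indicator f := by
    funext ζ
    by_cases hζ : ζ ∈ U
    · rw [Set.indicator_of_mem hζ, Set.indicator_of_mem hζ, mul_one]
    · rw [Set.indicator_of_notMem hζ, Set.indicator_of_notMem hζ, mul_zero]
  rw [hprod, integral_indicator (hmeas U), integral_indicator (hmeas U)] at hharris
  simp only [integral_const, smul_eq_mul, mul_one, measureReal_restrict_apply_univ] at hharris
  -- the same number is the vdBHK conditioned covariance at `X = ∅`
  have hcov : 0 < covD w x (∅ : Set (Fin n)) (fun C => F' {a | a = x ∨ ∃ e ∈ C, a ∈ e}) o := by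
    have hfx : ∀ ζ : BondConfig (Fin n), F' {a | a = x ∨ ∃ e ∈ openEdgeCluster ζ x, a ∈ e} = f ζ := by
      intro ζ; simp only [hfdef]; rw [KNPreFKG.openCluster_eq_setOf_openEdgeCluster]
    have hD : {ω : BondConfig (Fin n) | ∀ y ∈ (∅ : Set (Fin n)), ¬ (openGraph ω).Reachable x y} = univ := by
      ext ω; simp
    simp only [covD, hfx]
    rw [hD, probReal_univ, one_mul, univ_inter, Measure.restrict_univ]
    linarith [hharris, mul_comm ((prodBernoulli w).real U) (∫ ζ, f ζ ∂(prodBernoulli w))]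
  obtain ⟨e', he', -, η, hη, hlt, h1, h0⟩ :=
    (covD_clusterFun_pos_iff w E hE0 hE1 x (∅ : Set (Fin n)) o (Set.notMem_empty x) hox (Set.notMem_empty o) F' hF'mono).1 hcov
  refine ⟨e', he', η, fun g hg => (hη hg).1, ?_, h1, h0⟩
  simp only [hF'] at hlt
  linarith

end CSH

end Summit.CriticalPhenomena.PercolationContinuityZ3.Theorems

end
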